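import Mathlib
import Summits.Ventures.PercRepro2.Defs
import Summits.Ventures.PercRepro2.Graph
import Summits.Ventures.PercRepro2.Events
import Summits.Ventures.PercRepro2.Harris
import Summits.Ventures.PercRepro2.BHKAvoid
import Summits.Ventures.PercRepro2.VdBKahn

/-!
# The root-and-`b`-far lemma (L): row 2′ROOTLEAF-b (blind cell PercRepro2, mine-2 g12)

Four vertices `a₂ x a₃ o` of a finite weighted graph; `S = C(a₂)`, `T = C(x)`. With the events
`R_X = {a₂ ↮ X}` (`avoidAll`), `O = {a₂ ↮ o}`, `N = {x ↮ a₃}` and the seven probabilities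

  `r = P(R_x)`, `a = P(R_{x,a₃})`, `a₀ = P(R_{a₃})`, `b = P(R_{x,a₃} ∩ O)`, `b₀ = P(R_{a₃} ∩ O)`,
  `c = P(R_{x,a₃} ∩ N)`, `c' = P(R_{x,a₃} ∩ N ∩ O)`,

the lemma (L) of MINE2-CUTVERTEX.md §13.13 reads, cleared of the denominator `r²`,

  `0 ≤ c (b − r b₀) − c' (a − r a₀)`.

It closes the weighted five-point functional (HCOV) on the two-far-mark classes «a root and `b`
behind a cut vertex» (§13.8: `γ(1) ≥ 0`). PROOF (§13.14): the polynomial identity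

  `a · [c (b − r b₀) − c' (a − r a₀)] = (a − r a₀) (b c − a c') + r c (a₀ b − a b₀)`

with the three factors nonnegative by
* `a − r a₀ ≥ 0`: Harris for the decreasing events `R_x`, `R_{a₃}`;
* `b c − a c' ≥ 0`: BHK06 Thm 1.4 with set avoidance (`bhk_cross_cluster_avoid`, source `a₂`,
  other cluster `x`, avoided set `{x, a₃}`, up-sets `{W ∋ o}`, `{W ∋ a₃}`);
* `a₀ b − a b₀ ≥ 0`: van den Berg–Kahn Thm 1.2 (`vdBK`, `A = {o}`, `X = {x, a₃}`, `Y = {a₃}`).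
-/

namespace Summit.Ventures.PercRepro2
namespace RootLeafB

variable {V : Type*} {E : Type*} [Fintype E] [DecidableEq E] [Fintype V] [DecidableEq V]
  {R : Type*} [CommRing R] [LinearOrder R] [IsStrictOrderedRing R]

omit [Fintype E] [DecidableEq E] [Fintype V] [DecidableEq V] in
/-- `{a₂ ↮ X}` is a decreasing event. -/
lemma isLowerSet_avoidAll (ends : E → Sym2 V) (s : V) (X : Finset V) :
    IsLowerSet (avoidAll ends s X) := by
  intro ω ω' h hω t ht hc
  exact hω t ht (cluster_mono h s hc)

omit [Fintype E] [DecidableEq E] [Fintype V] in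
/-- Avoiding `{x, a₃}` is avoiding `x` and avoiding `a₃`. -/
lemma avoidAll_pair (ends : E → Sym2 V) (s x a₃ : V) :
    avoidAll ends s {x} ∩ avoidAll ends s {a₃} = avoidAll ends s {x, a₃} := by
  ext ω
  simp only [Set.mem_inter_iff, avoidAll, Set.mem_setOf_eq, Finset.mem_singleton,
    Finset.mem_insert, forall_eq, forall_eq_or_imp]

omit [Fintype E] [DecidableEq E] [Fintype V] [DecidableEq V] in
/-- `{C(s) ∋ v}` is the connection event `{s ↔ v}`. -/
lemma clusterInEvent_mem_eq (ends : E → Sym2 V) (s v : V) :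
    clusterInEvent ends s {W | v ∈ W} = connEvent ends s v := by
  ext ω
  simp only [mem_clusterInEvent, Set.mem_setOf_eq, cluster, mem_connEvent]

omit [Fintype E] [DecidableEq E] [Fintype V] [DecidableEq V] in
/-- The family of vertex sets containing `v` is an up-set. -/
lemma isUpperSet_mem (v : V) : IsUpperSet {W : Set V | v ∈ W} := fun _ _ h hW => h hW

/-- **Lemma (L), row 2′ROOTLEAF-b** (cleared form). -/
theorem rootleaf_b_nonneg (p : E → R) (hp : IsProbVec p) (ends : E → Sym2 V) (a₂ x a₃ o : V) :
    let Rx := avoidAll ends a₂ {x}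
    let R3 := avoidAll ends a₂ {a₃}
    let Rx3 := avoidAll ends a₂ {x, a₃}
    let O := (connEvent ends a₂ o)ᶜ
    let N := (connEvent ends x a₃)ᶜ
    0 ≤ prob p (Rx3 ∩ N) * (prob p (Rx3 ∩ O) - prob p Rx * prob p (R3 ∩ O)) -
        prob p (Rx3 ∩ N ∩ O) * (prob p Rx3 - prob p Rx * prob p R3) := by
  intro Rx R3 Rx3 O N
  -- names
  set r := prob p Rx with hr
  set a := prob p Rx3 with ha
  set a₀ := prob p R3 with ha₀
  set b := prob p (Rx3 ∩ O) with hb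
  set b₀ := prob p (R3 ∩ O) with hb₀
  set c := prob p (Rx3 ∩ N) with hc
  set c' := prob p (Rx3 ∩ N ∩ O) with hc'
  -- complements inside `Rx3` and `R3`
  have e1 : prob p (Rx3 ∩ connEvent ends a₂ o) = a - b := by
    have := prob_inter_add_prob_inter_compl p Rx3 (connEvent ends a₂ o)
    simp only [O] at hb ⊢; linarith
  have e2 : prob p (Rx3 ∩ connEvent ends x a₃) = a - c := by
    have := prob_inter_add_prob_inter_compl p Rx3 (connEvent ends x a₃)
    simp only [N] at hc ⊢; linarith
  have e3 : prob p (R3 ∩ connEvent ends a₂ o) = a₀ - b₀ := by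
    have := prob_inter_add_prob_inter_compl p R3 (connEvent ends a₂ o)
    simp only [O] at hb₀ ⊢; linarith
  have e4 : prob p (Rx3 ∩ connEvent ends a₂ o ∩ connEvent ends x a₃) = (a - b) - (c - c') := by
    have h1 := prob_inter_add_prob_inter_compl p (Rx3 ∩ connEvent ends a₂ o) (connEvent ends x a₃)
    have h2 := prob_inter_add_prob_inter_compl p (Rx3 ∩ N) (connEvent ends a₂ o)
    have h3 : Rx3 ∩ connEvent ends a₂ o ∩ (connEvent ends x a₃)ᶜ = Rx3 ∩ N ∩ connEvent ends a₂ o := by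
      simp only [N]; ext ω; simp only [Set.mem_inter_iff, Set.mem_compl_iff]; tauto
    rw [h3] at h1
    simp only [O] at hc' h2
    linarith
  -- (i) Harris
  have h1 : r * a₀ ≤ a := by
    have := prob_mul_prob_le_prob_inter_of_isLowerSet hp (isLowerSet_avoidAll ends a₂ {x})
      (isLowerSet_avoidAll ends a₂ {a₃})
    rw [avoidAll_pair] at this
    exact this
  -- (ii) BHK 1.4 with avoidance of `{x, a₃}`
  have h2 : a * c' ≤ b * c := by
    have key := bhk_cross_cluster_avoid p hp ends a₂ x (X := {x, a₃}) (by simp)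
      (isUpperSet_mem o) (isUpperSet_mem a₃)
    rw [clusterInEvent_mem_eq, clusterInEvent_mem_eq] at key
    have e : connEvent ends a₂ o ∩ connEvent ends x a₃ ∩ Rx3 =
        Rx3 ∩ connEvent ends a₂ o ∩ connEvent ends x a₃ := by
      ext ω; simp only [Set.mem_inter_iff]; tauto
    have e' : connEvent ends x a₃ ∩ Rx3 = Rx3 ∩ connEvent ends x a₃ := Set.inter_comm _ _
    have e'' : connEvent ends a₂ o ∩ Rx3 = Rx3 ∩ connEvent ends a₂ o := Set.inter_comm _ _
    rw [e, e', e'', e4, e1, e2] at key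
    nlinarith [key]
  -- (iii) van den Berg–Kahn 1.2
  have h3 : a * b₀ ≤ a₀ * b := by
    have key := vdBK p hp ends a₂ {o} ∅ {x, a₃} {a₃}
    have eA : connAll ends a₂ {o} = connEvent ends a₂ o := by
      ext ω; simp [connAll]
    have eB : connAll ends a₂ ∅ = Set.univ := by
      ext ω; simp [connAll]
    have eAB : ({o} : Finset V) ∪ ∅ = {o} := by simp
    have eXY : ({x, a₃} : Finset V) ∩ {a₃} = {a₃} := by
      ext t; simp only [Finset.mem_inter, Finset.mem_insert, Finset.mem_singleton]; tauto
    have eXY' : ({x, a₃} : Finset V) ∪ {a₃} = {x, a₃} := by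
      ext t; simp only [Finset.mem_union, Finset.mem_insert, Finset.mem_singleton]; tauto
    rw [eA, eB, eAB, eXY, eXY', Set.univ_inter, eA, Set.inter_comm, e1,
      Set.inter_comm, e3] at key
    nlinarith [key]
  -- the identity and the conclusion
  have hid : a * (c * (b - r * b₀) - c' * (a - r * a₀)) =
      (a - r * a₀) * (b * c - a * c') + r * c * (a₀ * b - a * b₀) := by ring
  have hr0 : 0 ≤ r := prob_nonneg hp _
  have hc0 : 0 ≤ c := prob_nonneg hp _
  have hprod : 0 ≤ a * (c * (b - r * b₀) - c' * (a - r * a₀)) := by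
    rw [hid]
    have t1 : 0 ≤ (a - r * a₀) * (b * c - a * c') := mul_nonneg (by linarith) (by linarith)
    have t2 : 0 ≤ r * c * (a₀ * b - a * b₀) := mul_nonneg (mul_nonneg hr0 hc0) (by linarith)
    linarith
  rcases (prob_nonneg hp Rx3).lt_or_eq with hapos | hazero
  · exact nonneg_of_mul_nonneg_right (by simpa [mul_comm] using hprod) hapos
  · -- `a = 0` forces `b = c = c' = 0`
    have hb0 : b = 0 := by
      apply le_antisymm _ (prob_nonneg hp _)
      calc b ≤ a := prob_mono hp Set.inter_subset_left
        _ = 0 := hazero.symm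
    have hc0' : c = 0 := by
      apply le_antisymm _ (prob_nonneg hp _)
      calc c ≤ a := prob_mono hp Set.inter_subset_left
        _ = 0 := hazero.symm
    have hc0'' : c' = 0 := by
      apply le_antisymm _ (prob_nonneg hp _)
      calc c' ≤ a := prob_mono hp (Set.inter_subset_left.trans Set.inter_subset_left)
        _ = 0 := hazero.symm
    rw [hb0, hc0', hc0'']; simp

end RootLeafB
end Summit.Ventures.PercRepro2
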